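import Mathlib.MeasureTheory.Measure.Lebesgue.EqHaar
import Mathlib.MeasureTheory.Measure.OpenPos
import Mathlib.Order.Filter.AtTopBot.Field
import Literature.Analysis.FluidPDE.SelfSimilar
import Literature.Analysis.FluidPDE.NSBoundedMildOseen
import HarnessLib

/-!
# Route FrozenSignCascade · crux `BoundedEnvelopeContinuation` — stub Z4: (L) ⇒ (L_M)

Helper file for the crux item stmt-NavierStokesRegularity-10579 (`BoundedEnvelopeContinuation`,
conjunct (B) of route `FrozenSignCascade`), line `registered`; lands `--supports` that item and
proves its stub `stub_liouvilleMorreyOfL` with exactly the registered signature.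

**The statement.** The Liouville conjecture (L) of Koch–Nadirashvili–Seregin–Šverák (2009, §1;
verbatim the definiens of `LiouvilleConjectureNS`): every bounded ancient mild solution (`ν = 1`)
with a.e.-strongly measurable slices has a.e.-constant slices on the open past. It implies the
Morrey-class Liouville statement (L_M): a bounded ancient mild solution, smooth on `(-∞,0) × ℝ³`,
with the uniform local energy bound `∫_{B_r(y)} ‖v t‖² ≤ M' r` at all radii, vanishes identically
on the open past.

**Proof.** Fix `t < 0`. The slice `v t` is continuous (restriction of the smooth space-time field
to `{t} × ℝ³`), hence a.e.-strongly measurable, so (L) gives a constant `b` with `v t = b` a.e.,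
and by continuity (Lebesgue measure charges open sets) `v t = b` everywhere. The Morrey bound then
reads `‖b‖² |B₁| r³ ≤ M' r`, i.e. `r² (|B₁| ‖b‖²) ≤ M'` for every `r > 0`; were `b ≠ 0` the left
side would tend to `+∞`. Hence `b = 0`. The Oseen identity in the signature is not needed.

References: G. Koch, N. Nadirashvili, G. Seregin, V. Šverák, *Liouville theorems for the
Navier–Stokes equations and applications*, Acta Math. 203 (2009), §1 (arXiv:0709.3599); folklore.
-/

noncomputable section

set_option linter.dupNamespace false -- nested layout Summit.<S>.<Sub>, Sub = S (D-0017)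

open Set MeasureTheory Filter Topology Metric Function
open Literature.Analysis Literature.Analysis.FluidPDE

namespace Summit.NavierStokesRegularity.NavierStokesRegularity.Theorems.BoundedEnvelope

/-- **Slices of a space-time smooth field are continuous.** If `uncurry v` is `C^∞` on the open
past `(-∞,0) × ℝ³`, then every slice `v t`, `t < 0`, is continuous (compose with `x ↦ (t, x)`).
[folklore] -/
theorem continuous_slice_of_contDiffOn_past
    {v : ℝ → EuclideanSpace ℝ (Fin 3) → EuclideanSpace ℝ (Fin 3)}
    (hv : ContDiffOn ℝ (⊤ : ℕ∞) (uncurry v) (Set.Iio 0 ×ˢ Set.univ)) {t : ℝ} (ht : t < 0) :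
    Continuous (v t) := by
  have h : Continuous fun x : EuclideanSpace ℝ (Fin 3) => uncurry v (t, x) :=
    hv.continuousOn.comp_continuous (continuous_const.prodMk continuous_id)
      fun x => ⟨ht, Set.mem_univ x⟩
  exact h

/-- **A constant with a linear-in-`r` local energy bound at all radii vanishes.** If
`∫_{B_r(0)} ‖b‖² ≤ M' r` for every `r > 0` in `ℝ³`, then `b = 0`: the left side is
`|B₁| r³ ‖b‖²`, so `r² (|B₁| ‖b‖²) ≤ M'` for all `r > 0`, impossible for `b ≠ 0` as `r → ∞`.
[folklore] -/
theorem eq_zero_of_setIntegral_ball_const_le_linear (b : EuclideanSpace ℝ (Fin 3)) (M' : ℝ)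
    (h : ∀ r : ℝ, 0 < r →
      ∫ _x in Metric.ball (0 : EuclideanSpace ℝ (Fin 3)) r, ‖b‖ ^ 2 ≤ M' * r) :
    b = 0 := by
  set c : ℝ := (volume (Metric.ball (0 : EuclideanSpace ℝ (Fin 3)) 1)).toReal with hc_def
  have hc : 0 < c :=
    ENNReal.toReal_pos (measure_ball_pos volume (0 : EuclideanSpace ℝ (Fin 3)) one_pos).ne'
      measure_ball_lt_top.ne
  have hK : ∀ r : ℝ, 0 < r → r ^ 2 * (c * ‖b‖ ^ 2) ≤ M' := by
    intro r hr
    have h1 := h r hr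
    rw [setIntegral_const, smul_eq_mul, measureReal_def,
      Measure.addHaar_ball_of_pos volume (0 : EuclideanSpace ℝ (Fin 3)) hr,
      finrank_euclideanSpace_fin, ENNReal.toReal_mul, ENNReal.toReal_ofReal (pow_nonneg hr.le 3)]
      at h1
    have h2 : r ^ 2 * (c * ‖b‖ ^ 2) * r ≤ M' * r := by
      calc r ^ 2 * (c * ‖b‖ ^ 2) * r = r ^ 3 * c * ‖b‖ ^ 2 := by ring
        _ ≤ M' * r := h1
    exact le_of_mul_le_mul_right h2 hr
  by_contra hb
  have hKpos : 0 < c * ‖b‖ ^ 2 := mul_pos hc (pow_pos (norm_pos_iff.mpr hb) 2)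
  have hT : Tendsto (fun r : ℝ => r ^ 2 * (c * ‖b‖ ^ 2)) atTop atTop :=
    (tendsto_pow_atTop two_ne_zero).atTop_mul_const hKpos
  obtain ⟨r, hr1, hr2⟩ := ((hT.eventually_gt_atTop M').and (eventually_gt_atTop 0)).exists
  exact (not_le.mpr hr1) (hK r hr2)

/-- **Stub Z4 — `stub_liouvilleMorreyOfL`: the KNSS Liouville conjecture (L) implies the
Morrey-class Liouville statement (L_M).** Under (L) (first hypothesis, verbatim the definiens of
`LiouvilleConjectureNS`), a bounded ancient mild solution `v` (`ν = 1`), smooth on `(-∞,0) × ℝ³`,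
with `∫_{B_r(y)} ‖v t‖² ≤ M' r` for all `t < 0`, `y`, `r > 0`, vanishes on the open past: each
slice is continuous, hence a.e. (so everywhere) equal to a constant `b`, and
`‖b‖² |B₁| r³ ≤ M' r` for all `r > 0` forces `b = 0`. (The Oseen identity is not used.)
[cite: KochNadirashviliSereginSverak2009, §1 conjecture (L) (arXiv:0709.3599)] -/
theorem stub_liouvilleMorreyOfL :
    (∀ u : ℝ → EuclideanSpace ℝ (Fin 3) → EuclideanSpace ℝ (Fin 3),
      IsBoundedAncientMildSolution 1 u → (∀ t < 0, AEStronglyMeasurable (u t) volume) →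
        ∀ t < 0, ∃ b : EuclideanSpace ℝ (Fin 3), u t =ᵐ[volume] fun _ => b) →
    ∀ v : ℝ → EuclideanSpace ℝ (Fin 3) → EuclideanSpace ℝ (Fin 3),
      IsBoundedAncientMildSolution 1 v →
      ContDiffOn ℝ (⊤ : ℕ∞) (uncurry v) (Set.Iio 0 ×ˢ Set.univ) →
      (∀ s t : ℝ, s < t → t < 0 → ∀ x,
        v t x = UnboundedOperators.heatExtension (v s) (t - s) x - oseenDuhamel 1 s v v t x) →
      (∃ M' : ℝ, ∀ t < 0, ∀ (y : EuclideanSpace ℝ (Fin 3)) (r : ℝ), 0 < r →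
        ∫ x in Metric.ball y r, ‖v t x‖ ^ 2 ≤ M' * r) →
      ∀ t < 0, ∀ x, v t x = 0 := by
  intro hL v hv hsmooth _hoseen hM t ht x
  have hcont : ∀ s < (0 : ℝ), Continuous (v s) := fun s hs =>
    continuous_slice_of_contDiffOn_past hsmooth hs
  obtain ⟨b, hb⟩ := hL v hv (fun s hs => (hcont s hs).aestronglyMeasurable) t ht
  have hvt : v t = fun _ => b := ((hcont t ht).ae_eq_iff_eq volume continuous_const).mp hb
  obtain ⟨M', hM'⟩ := hM
  have hb0 : b = 0 := by
    refine eq_zero_of_setIntegral_ball_const_le_linear b M' (fun r hr => ?_)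
    have h1 := hM' t ht 0 r hr
    simpa only [hvt] using h1
  rw [hvt, hb0]

end Summit.NavierStokesRegularity.NavierStokesRegularity.Theorems.BoundedEnvelope

end
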